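import Summits.BirchSwinnertonDyer.Rank1Residual.Supersingular.DescentLowerBoundRankOne
import Literature.NumberTheory.EllipticCurves.SelmerGroupCardinality
import Literature.NumberTheory.EllipticCurves.Rank1Residual.Typed.HigherDescentSelmerCertificate
import HarnessLib

/-!
# Supersingular family at `p = 3`, analytic rank `≤ 1`: the typed LOWER half from the COUNT of a
# level-`n` descent, `n ^ rank · c ∣ #Sel^(n)(E/ℚ) ⇒ c ∣ #Ш(E/ℚ)` — the `#Ш_an = 81` rows of
# classes X6 / X7 / X8 (cell `b2b-bsdres`, supersingular family, prover B = unit `b2b-bsdres-additive-p3`,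
# gen 19; CLASS-CLOSURE class lead N6·O3)

HONEST FRAMING (run/shared/lean/b2b/bsd-rank1-residual/, verbatim in every file): the goal of the
cell is to DELETE the COMBINATION-SHAPED residual classes of the Birch–Swinnerton-Dyer formula for
ALL analytic-rank `≤ 1` elliptic curves over `ℚ` — "full BSD formula for every rank `≤ 1` curve in
class `C`" assembled STRICTLY from published theorems — so that the rank-`≤ 1` remainder becomes
exactly the CONSTRUCTION-SHAPED classes, which are TYPED (missing-input `Prop`s), NOT attempted.
This is not "finishing BSD". Prove what is provable now; shrink each hard class to its core with
data; no claim beyond stated classes. X6 / X7 / X8 stay CONSTRUCTION-SHAPED; nothing is booked here;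
PER-PAIR certificate consumers only, every input a PUBLISHED theorem taken by name plus one finite
certificate line per curve. Theorems only (no definition, no named fact).

Companion of `Supersingular/DescentLowerBound.lean` (x10b, p212413: rank `0`, certificate line
`Sel^(p)(E/ℚ) ≠ 0`, `ord_p #Ш_an ≤ 2`) and `Supersingular/DescentLowerBoundRankOne.lean` (x10b:
`p^{r+1} ∣ #Sel^(p)`, `ord_p #Ш_an ≤ 2`). Those serve the `#Ш_an = 9` rows. WHY THIS FILE: the
rank-`0` good-supersingular-at-`3` residue with SURJECTIVE `ρ̄_{E,3}` that no published input plus a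
FIRST `3`-descent reaches is exactly the `#Ш_an = 81` slice — class-closure folders N6 (X8 r0) 33
cells, N5@3 (X7 r0) 11, N4@3 (X6 r0) 3 (obsanat `pairs.tsv` of record; = harvest-1 GEN 23's
`desc3surj` verdict `OPEN(ord_3 #Ш_an = 4; dim Sel3 = 2/2 ⇒ 9 ∣ #Ш only; needs 27 ∣ #Ш)` on all 47,
two engines): there Wuthrich 2014 Prop. 21 gives `ord_3 #Ш ≤ 4`, a first descent gives
`Ш(E)[3] ≅ (ℤ/3)²` hence only `9 ∣ #Ш`, and `BSD(E,3) ⟺ #Ш(E)[3^∞] = 81 ⟺ Ш(E)[3^∞] ≅ (ℤ/9)²`.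
The finite certificate that closes such a pair from PUBLISHED inputs is the COUNT of a level-`9`
descent: `#Sel^(9)(E/ℚ) = 81` (rank `0`, `E(ℚ)[3] = 0`, so `Sel^(9) ≅ Ш[9]`; a second `3`-descent in
the sense of Creutz, *Second p-descents on elliptic curves*, Math. Comp. 83 (2014) — both generators
of `Ш[3]` lift to `Sel^(9)` —, the class-closure instrument `SEL3CT@3` / B-1 of `cc-eng-4`), read by
the descent count `#Sel^(n)(E/K) = n^{rank}·#E(K)[n]·#Ш(E/K)[n]` (tree theorem
`card_selmerGroup_eq_pow_rank_mul`, PROVED from Silverman X.4.2 + Mordell–Weil) as `81 ∣ #Ш`, and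
then Cassels–Tate squareness is not even needed (`27 ∣ #Ш` already suffices by
`missingLowerBoundAt_of_casselsTate_of_pow_dvd`, `k = 2`).

**This file proves** (binders: `hCT` = bsd.S18 Cassels–Tate pairing, `hW` = Wuthrich 2014 Prop. 21,
`hGZK` = bsd.S17 Gross–Zagier–Kolyvagin, `hmod` = modularity — all PUBLISHED; the certificate is
per curve):
* §1 (any number field) `torsionBy_pow_eq_bot_of_not_dvd_torsionOrder`,
  `natCard_torsionBy_pow_eq_one_of_not_dvd_torsionOrder` (`p ∤ #E(K)_tors ⇒ E(K)[p^j] = 0`);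
  `dvd_shaOrder_of_mul_dvd_card_selmerGroup` — THE COUNT READING: `#E(K)[n] = b > 0` and
  `n^{rank}·b·c ∣ #Sel^(n)(E/K)` ⇒ `c ∣ #Ш(E/K)` (`#Ш := Nat.card`, no finiteness needed);
  `pow_dvd_shaOrder_of_dvd_card_selmerGroup_pow` (the `n = p^j`, `p ∤ #E(K)_tors` form).
* §2 (over `ℚ`, analytic rank `≤ 1`, class-free)
  `missingLowerBoundAt_of_casselsTate_of_dvd_card_selmerGroup_pow`: GZK + Cassels–Tate +
  `ord_p #Ш_an ≤ 2k` + `p^{j·r_an + (2k−1)} ∣ #Sel^(p^j)(E/ℚ)` ⇒ `MissingLowerBoundAt W p`.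
* §3 (rank `0`, upper half = Wuthrich Prop. 21) `X8.bsdp_rankZero_of_casselsTate_of_dvd_card_selmerGroup_pow_of_surj`
  / `_of_semistable`, `X7.…_of_surj`, `X6.…`; and the `p = 3`, `#Ш_an = 81`, level-`9` records' shape
  `X8.bsdp_three_rankZero_of_card_selmerNine_of_surj` / `_of_semistable`, `X7.…`, `X6.…`
  (certificate line `81 ∣ #Sel^(9)(E/ℚ)`).
* §4 (rank `≤ 1`, X6 only — the rank-`1` upper half in print is Sprung 2024 Cor. 1.3 (ii), as in
  `DescentLowerBoundRankOne.lean`) `X6.bsdp_of_casselsTate_of_dvd_card_selmerGroup_pow`.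
NOT here: any Selmer-group evaluation (the engines' side); any statement about a class; the EXACT
form of the second-descent certificate (`#Sel^(3)`, `#Sel^(9)` ⇒ `ord_3 #Ш` with NO upper-bound input,
both ranks) is ALREADY the tree's class-free `Typed.bsdp_of_card_selmer_stable`
(`Typed/HigherDescentSelmerCertificate.lean`) — this file adds only the one-sided (lower) reading that
pairs with Wuthrich's bound when the level-`9` count is `≥ 81` but stabilisation `Ш[27] = Ш[9]` is not
computed.

References: [SilvermanAEC2009] Thm. VIII.6.7, X.4.2, X.4.14; [Cremona1997] §3.6; [Wuthrich2014]
Prop. 21; [Sprung2024] Cor. 1.3; [Serre1972] §1.11 Prop. 12, §5.4 Prop. 21; [Miller2011LMS] Def. 1.1;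
Creutz, Math. Comp. 83 (2014) 365–409 (second `p`-descent; method of the instrument, not a kernel input).
Evidence: `HOME/b2b-bsdres-harvest-1/g23/desc3surj/desc3surj_join.tsv` (47 OPEN rows),
`HOME/class-closure/N6/WEEK-2026-08-28.md` §12, `HOME/b2b-bsdres-additive-p3/g19/`.
-/

noncomputable section

open scoped Classical

open WeierstrassCurve Literature.NumberTheory.EllipticCurves
  Literature.NumberTheory.EllipticCurves.Rank1Residual
  Literature.NumberTheory.EllipticCurves.Rank1Residual.Typed
  Literature.NumberTheory.EllipticCurves.Wuthrich2014

namespace Summit.BirchSwinnertonDyer.Rank1Residual.Supersingular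

/-! ### §1. The count reading over any number field -/

section General

variable {K : Type*} [Field K] [NumberField K] (W : WeierstrassCurve K) [W.IsElliptic]

omit [NumberField K] [W.IsElliptic] in
/-- `p ∤ #E(K)_tors ⇒ E(K)[p^j] = 0`: a non-zero point killed by `p^j` has order `p^i`, `i ≥ 1`, a
divisor of `#E(K)_tors`. [cite: SilvermanAEC2009, Thm VIII.6.7] -/
theorem torsionBy_pow_eq_bot_of_not_dvd_torsionOrder (p j : ℕ) [hp : Fact p.Prime]
    (htors : ¬ p ∣ W.torsionOrder) :
    AddSubgroup.torsionBy W.toAffine.Point ((p ^ j : ℕ) : ℤ) = ⊥ := by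
  rw [eq_bot_iff]
  intro P hP
  rw [AddSubgroup.mem_bot]
  by_contra hP0
  have hpP : (p ^ j) • P = 0 := AddSubgroup.torsionBy.nsmul_iff.mp hP
  have hord : addOrderOf P ∣ p ^ j := addOrderOf_dvd_of_nsmul_eq_zero hpP
  obtain ⟨i, -, heq⟩ := (Nat.dvd_prime_pow hp.out).mp hord
  have hi0 : i ≠ 0 := by
    rintro rfl
    rw [pow_zero, AddMonoid.addOrderOf_eq_one_iff] at heq
    exact hP0 heq
  have hpdvd : p ∣ addOrderOf P := by rw [heq]; exact dvd_pow_self p hi0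
  have hfin : IsOfFinAddOrder P := by
    rw [← addOrderOf_pos_iff, heq]; exact pow_pos hp.out.pos i
  have hmemT : P ∈ AddCommGroup.torsion W.toAffine.Point := by
    rw [AddCommGroup.mem_torsion]; exact hfin
  have hordT : addOrderOf (⟨P, hmemT⟩ : AddCommGroup.torsion W.toAffine.Point) = addOrderOf P :=
    AddSubgroup.addOrderOf_mk P hmemT
  apply htors
  have h := addOrderOf_dvd_natCard (⟨P, hmemT⟩ : AddCommGroup.torsion W.toAffine.Point)
  rw [hordT] at h
  exact hpdvd.trans h

omit [NumberField K] [W.IsElliptic] in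
/-- `p ∤ #E(K)_tors ⇒ #E(K)[p^j] = 1`. [cite: SilvermanAEC2009, Thm VIII.6.7] -/
theorem natCard_torsionBy_pow_eq_one_of_not_dvd_torsionOrder (p j : ℕ) [Fact p.Prime]
    (htors : ¬ p ∣ W.torsionOrder) :
    Nat.card (AddSubgroup.torsionBy W.toAffine.Point ((p ^ j : ℕ) : ℤ)) = 1 := by
  rw [torsionBy_pow_eq_bot_of_not_dvd_torsionOrder W p j htors]
  exact AddSubgroup.card_bot

/-- **The COUNT reading of a complete level-`n` descent, lower direction.** If `#E(K)[n] = b` with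
`b > 0` and `n ^ rank E(K) · b · c ∣ #Sel^(n)(E/K)`, then `c ∣ #Ш(E/K)` (`#` = `Nat.card`; no
finiteness of `Ш` needed: an infinite `Ш` has `Nat.card = 0`). By the PROVED descent count
`#Sel^(n) = n^{rank}·#E(K)[n]·#Ш(E/K)[n]` (`card_selmerGroup_eq_pow_rank_mul`: Silverman X.4.2 +
Mordell–Weil), `c ∣ #Ш[n]`, and `Ш[n] ≤ Ш` (Lagrange). [cite: SilvermanAEC2009, Thm X.4.2(a)]
[cite: Cremona1997, §3.6, p. 73] -/
theorem dvd_shaOrder_of_mul_dvd_card_selmerGroup (n : ℕ) [NeZero n] {b c : ℕ}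
    (hb : Nat.card (AddSubgroup.torsionBy W.toAffine.Point (n : ℤ)) = b) (hbpos : 0 < b)
    (hcard : n ^ W.mordellWeilRank * b * c ∣ Nat.card (W.selmerGroup (n : ℤ))) :
    c ∣ W.shaOrder := by
  rw [card_selmerGroup_eq_pow_rank_mul W n, hb] at hcard
  have hapos : 0 < n ^ W.mordellWeilRank * b := Nat.mul_pos (pow_pos (NeZero.pos n) _) hbpos
  have hc : c ∣ Nat.card (W.sha ⊓ AddSubgroup.torsionBy W.galH1 (n : ℕ) : AddSubgroup W.galH1) :=
    Nat.dvd_of_mul_dvd_mul_left hapos hcard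
  exact hc.trans (AddSubgroup.card_dvd_of_le inf_le_left)

/-- **Prime-power level, no rational `p`-torsion: `p ^ (j · rank E(K) + m) ∣ #Sel^(p^j)(E/K)` ⇒
`p ^ m ∣ #Ш(E/K)`.** For `j = 1` this reads `dim_𝔽_p Sel^(p) ≥ rank + m ⇒ p^m ∣ #Ш`; for `j = 2`
in rank `0` it reads a second descent's count `#Sel^(p²) ≥ p^m` as `p^m ∣ #Ш`.
[cite: SilvermanAEC2009, Thm X.4.2(a)] [cite: Cremona1997, §3.6, p. 73] -/
theorem pow_dvd_shaOrder_of_dvd_card_selmerGroup_pow (p j : ℕ) [hp : Fact p.Prime]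
    (htors : ¬ p ∣ W.torsionOrder) {m : ℕ}
    (hcard : p ^ (j * W.mordellWeilRank + m) ∣ Nat.card (W.selmerGroup ((p ^ j : ℕ) : ℤ))) :
    p ^ m ∣ W.shaOrder := by
  haveI : NeZero (p ^ j) := ⟨pow_ne_zero _ hp.out.ne_zero⟩
  refine dvd_shaOrder_of_mul_dvd_card_selmerGroup W (p ^ j)
    (natCard_torsionBy_pow_eq_one_of_not_dvd_torsionOrder W p j htors) Nat.one_pos ?_
  rwa [mul_one, ← pow_mul, ← pow_add]

end General

/-! ### §2. Over `ℚ`, analytic rank `≤ 1`: the typed lower half from the count -/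

section OverQ

variable (W : WeierstrassCurve ℚ) [W.IsElliptic] (p : ℕ) [Fact p.Prime]

/-- **The typed LOWER half from the count of a level-`p^j` descent, analytic rank `≤ 1`,
class-free.** At a pair with `ord_{s=1} L(E,s) ≤ 1`, `#Ш(E/ℚ)_an = q` with `ord_p q ≤ 2k`,
`p ∤ #E(ℚ)_tors` and `p ^ (j · r_an + (2k − 1)) ∣ #Sel^(p^j)(E/ℚ)`: `MissingLowerBoundAt W p`
(`ord_p #Ш_an ≤ ord_p #Ш`). GZK (`hGZK`) gives `rank = r_an` and `Ш` finite;
`pow_dvd_shaOrder_of_dvd_card_selmerGroup_pow` gives `p^{2k−1} ∣ #Ш`; Cassels–Tate squareness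
(`hCT`, `missingLowerBoundAt_of_casselsTate_of_pow_dvd`) gives `p^{2k} ∣ #Ш`. Instances: `j = 1`,
`k = 1` = the `#Ш_an = 9` first-descent rows (x10b's files); `j = 2`, `k = 2`, `r_an = 0` = the
`#Ш_an = 81` rows from a level-`9` count `27 ∣ #Sel^(9)`. [cite: SilvermanAEC2009, Thm. X.4.14]
[cite: Miller2011LMS, Def. 1.1 (arXiv:1010.2431 p. 3)] -/
theorem missingLowerBoundAt_of_casselsTate_of_dvd_card_selmerGroup_pow
    (hCT : exists_casselsTate_pairing (K := ℚ))
    (hGZK : rank_eq_analyticRank_of_analyticRank_le_one) (hr : W.analyticRank ≤ 1) (j : ℕ)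
    (htors : ¬ p ∣ W.torsionOrder) {q : ℚ} (hq : shaAn W = (q : ℂ)) {k : ℕ}
    (hv : padicValRat p q ≤ 2 * k)
    (hcard : p ^ (j * W.analyticRank + (2 * k - 1)) ∣ Nat.card (W.selmerGroup ((p ^ j : ℕ) : ℤ))) :
    MissingLowerBoundAt W p := by
  have hrank : W.mordellWeilRank = W.analyticRank := (hGZK W hr).1
  have hdvd : p ^ (2 * k - 1) ∣ W.shaOrder :=
    pow_dvd_shaOrder_of_dvd_card_selmerGroup_pow W p j htors (by rw [hrank]; exact hcard)
  exact missingLowerBoundAt_of_casselsTate_of_pow_dvd W p hCT (hGZK W hr).2 hq hv hdvd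

/-! ### §3. Rank `0`: `BSD(E,p)` with Wuthrich's upper half — X8 / X7 / X6 -/

variable [W.IsGloballyMinimal]

/-- **X8 ∩ {r_an = 0}, SURJECTIVE `ρ̄_{E,3}` (per-pair datum), `ord_3 #Ш_an ≤ 2k`: `BSD(E,p)` from
PUBLISHED theorems + the count certificate `p^{2k−1} ∣ #Sel^(p^j)(E/ℚ)`** (rank `0`: `j·r_an = 0`).
Inputs by name: Cassels–Tate (`hCT`), Wuthrich 2014 Prop. 21 (`hW`, image proviso `hs`), GZK
(`hGZK`), modularity (`hmod`); `p ∤ #E(ℚ)_tors` from `ClassX8.irr'`; consumer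
`X8.bsdp_of_missingLowerBoundAt_of_surj`. Per-pair; NOT a class theorem.
[cite: Wuthrich2014, Prop. 21 (p. 400)] [cite: SilvermanAEC2009, Thm. X.4.14]
[cite: Serre1972, §1.11 Prop. 12] [cite: Miller2011LMS, §1 and Def. 1.1] -/
theorem X8.bsdp_rankZero_of_casselsTate_of_dvd_card_selmerGroup_pow_of_surj
    (hCT : exists_casselsTate_pairing (K := ℚ)) (hW : sha_dvd_analyticSha)
    (hGZK : rank_eq_analyticRank_of_analyticRank_le_one) (hmod : hasEntireLFunction_rat)
    (hX : ClassX8 W p) (hs : Surj W p) (hr : W.analyticRank = 0) (j : ℕ)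
    {q : ℚ} (hq : shaAn W = (q : ℂ)) {k : ℕ} (hv : padicValRat p q ≤ 2 * k)
    (hcard : p ^ (2 * k - 1) ∣ Nat.card (W.selmerGroup ((p ^ j : ℕ) : ℤ))) : BSDp W p :=
  X8.bsdp_of_missingLowerBoundAt_of_surj W p hW hGZK hmod hX hs hr
    (missingLowerBoundAt_of_casselsTate_of_dvd_card_selmerGroup_pow W p hCT hGZK (by omega) j
      (not_dvd_torsionOrder_of_irr W p (ClassX8.irr' W p hX)) hq hv (by rw [hr, mul_zero, zero_add]; exact hcard))

/-- **X8 ∩ {sst} ∩ {r_an = 0}, `ord_3 #Ш_an ≤ 2k`: `BSD(E,p)` from PUBLISHED theorems + the count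
certificate `p^{2k−1} ∣ #Sel^(p^j)(E/ℚ)`, NO image binder** (`ClassX8.surj_of_semistable`, Serre
§5.4 Prop. 21 i)). [cite: Wuthrich2014, Prop. 21 (p. 400)] [cite: SilvermanAEC2009, Thm. X.4.14]
[cite: Serre1972, §1.11 Prop. 12 and §5.4 Prop. 21 i)] [cite: Miller2011LMS, §1 and Def. 1.1] -/
theorem X8.bsdp_rankZero_of_casselsTate_of_dvd_card_selmerGroup_pow_of_semistable
    (hCT : exists_casselsTate_pairing (K := ℚ)) (hW : sha_dvd_analyticSha)
    (hGZK : rank_eq_analyticRank_of_analyticRank_le_one) (hmod : hasEntireLFunction_rat)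
    (hX : ClassX8 W p) (hsst : Semistable W) (hr : W.analyticRank = 0) (j : ℕ)
    {q : ℚ} (hq : shaAn W = (q : ℂ)) {k : ℕ} (hv : padicValRat p q ≤ 2 * k)
    (hcard : p ^ (2 * k - 1) ∣ Nat.card (W.selmerGroup ((p ^ j : ℕ) : ℤ))) : BSDp W p :=
  X8.bsdp_of_missingLowerBoundAt_of_semistable W p hW hGZK hmod hX hsst hr
    (missingLowerBoundAt_of_casselsTate_of_dvd_card_selmerGroup_pow W p hCT hGZK (by omega) j
      (not_dvd_torsionOrder_of_irr W p (ClassX8.irr' W p hX)) hq hv (by rw [hr, mul_zero, zero_add]; exact hcard))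

/-- **X7 ∩ {r_an = 0}, odd `p`, SURJECTIVE `ρ̄_{E,p}` (per-pair datum), `ord_p #Ш_an ≤ 2k`:
`BSD(E,p)` from PUBLISHED theorems + the count certificate `p^{2k−1} ∣ #Sel^(p^j)(E/ℚ)`.**
Consumer `X7.bsdp_of_missingLowerBoundAt_of_surj`; `p ∤ #E(ℚ)_tors` from `ClassX7.irr`.
[cite: Wuthrich2014, Prop. 21 (p. 400)] [cite: SilvermanAEC2009, Thm. X.4.14]
[cite: Serre1972, §1.11 Prop. 12] [cite: Miller2011LMS, §1 and Def. 1.1] -/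
theorem X7.bsdp_rankZero_of_casselsTate_of_dvd_card_selmerGroup_pow_of_surj
    (hCT : exists_casselsTate_pairing (K := ℚ)) (hW : sha_dvd_analyticSha)
    (hGZK : rank_eq_analyticRank_of_analyticRank_le_one) (hmod : hasEntireLFunction_rat)
    (hp : p ≠ 2) (hX : ClassX7 W p) (hs : Surj W p) (hr : W.analyticRank = 0) (j : ℕ)
    {q : ℚ} (hq : shaAn W = (q : ℂ)) {k : ℕ} (hv : padicValRat p q ≤ 2 * k)
    (hcard : p ^ (2 * k - 1) ∣ Nat.card (W.selmerGroup ((p ^ j : ℕ) : ℤ))) : BSDp W p :=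
  X7.bsdp_of_missingLowerBoundAt_of_surj W p hW hGZK hmod hp hX hs hr
    (missingLowerBoundAt_of_casselsTate_of_dvd_card_selmerGroup_pow W p hCT hGZK (by omega) j
      (not_dvd_torsionOrder_of_irr W p (ClassX7.irr W p hp hX)) hq hv (by rw [hr, mul_zero, zero_add]; exact hcard))

/-- **X6 ∩ {r_an = 0}, odd `p`, `ord_p #Ш_an ≤ 2k`: `BSD(E,p)` from PUBLISHED theorems + the count
certificate `p^{2k−1} ∣ #Sel^(p^j)(E/ℚ)`** (image proviso automatic, `ClassX6.surj`; `p ∤ #E(ℚ)_tors`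
from `ClassX6.irr`). [cite: Wuthrich2014, Prop. 21 (p. 400)] [cite: SilvermanAEC2009, Thm. X.4.14]
[cite: Serre1972, §1.11 Prop. 12 and §5.4 Prop. 21 i)] [cite: Miller2011LMS, §1 and Def. 1.1] -/
theorem X6.bsdp_rankZero_of_casselsTate_of_dvd_card_selmerGroup_pow
    (hCT : exists_casselsTate_pairing (K := ℚ)) (hW : sha_dvd_analyticSha)
    (hGZK : rank_eq_analyticRank_of_analyticRank_le_one) (hmod : hasEntireLFunction_rat)
    (hp : p ≠ 2) (hX : ClassX6 W p) (hr : W.analyticRank = 0) (j : ℕ)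
    {q : ℚ} (hq : shaAn W = (q : ℂ)) {k : ℕ} (hv : padicValRat p q ≤ 2 * k)
    (hcard : p ^ (2 * k - 1) ∣ Nat.card (W.selmerGroup ((p ^ j : ℕ) : ℤ))) : BSDp W p :=
  X6.bsdp_of_missingLowerBoundAt_of_analyticRank_eq_zero W p hW hGZK hmod hp hX hr
    (missingLowerBoundAt_of_casselsTate_of_dvd_card_selmerGroup_pow W p hCT hGZK (by omega) j
      (not_dvd_torsionOrder_of_irr W p (ClassX6.irr W p hp hX)) hq hv (by rw [hr, mul_zero, zero_add]; exact hcard))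

/-! ### §3b. The shape of the `#Ш_an = 81` records at `p = 3`: ONE line `81 ∣ #Sel^(9)(E/ℚ)` -/

/-- **X8 ∩ {r_an = 0} ∩ {surj(3)} ∩ {ord_3 #Ш_an ≤ 4}: `BSD(E,3)` from PUBLISHED theorems + the
level-`9` count `81 ∣ #Sel^(9)(E/ℚ)`** — in rank `0` with `E(ℚ)[3] = 0`, `Sel^(9)(E/ℚ) ≅ Ш(E/ℚ)[9]`,
so the line says `Ш[9] ⊋ Ш[3] ≅ (ℤ/3)²`, i.e. both generators of `Ш[3]` are divisible by `3` in `Ш`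
(a second `3`-descent). The census targets are class-closure N6's 33 cells with `#Ш_an = 81·u`
(all `dim Sel₃ = 2` on two engines, harvest-1 GEN 23). Per-pair; NOT a class theorem.
[cite: Wuthrich2014, Prop. 21 (p. 400)] [cite: SilvermanAEC2009, Thm. X.4.2(a) and X.4.14]
[cite: Miller2011LMS, §1 and Def. 1.1] -/
theorem X8.bsdp_three_rankZero_of_card_selmerNine_of_surj
    (hCT : exists_casselsTate_pairing (K := ℚ)) (hW : sha_dvd_analyticSha)
    (hGZK : rank_eq_analyticRank_of_analyticRank_le_one) (hmod : hasEntireLFunction_rat)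
    (hX : ClassX8 W 3) (hs : Surj W 3) (hr : W.analyticRank = 0)
    {q : ℚ} (hq : shaAn W = (q : ℂ)) (hv : padicValRat 3 q ≤ 4)
    (hcard : 81 ∣ Nat.card (W.selmerGroup (9 : ℤ))) : BSDp W 3 := by
  have h9 : ((3 ^ 2 : ℕ) : ℤ) = 9 := by norm_num
  have hcard' : 3 ^ (2 * 2 - 1) ∣ Nat.card (W.selmerGroup ((3 ^ 2 : ℕ) : ℤ)) := by
    rw [h9]; exact dvd_trans (by norm_num) hcard
  exact X8.bsdp_rankZero_of_casselsTate_of_dvd_card_selmerGroup_pow_of_surj W 3 hCT hW hGZK hmod hX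
    hs hr 2 hq (k := 2) (by norm_num; exact hv) hcard'

/-- **X8 ∩ {sst} ∩ {r_an = 0} ∩ {ord_3 #Ш_an ≤ 4}: `BSD(E,3)` from PUBLISHED theorems + the level-`9`
count `81 ∣ #Sel^(9)(E/ℚ)`, no image binder.** [cite: Wuthrich2014, Prop. 21 (p. 400)]
[cite: SilvermanAEC2009, Thm. X.4.2(a) and X.4.14] [cite: Serre1972, §5.4 Prop. 21 i)] [cite: Miller2011LMS, §1 and Def. 1.1] -/
theorem X8.bsdp_three_rankZero_of_card_selmerNine_of_semistable
    (hCT : exists_casselsTate_pairing (K := ℚ)) (hW : sha_dvd_analyticSha)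
    (hGZK : rank_eq_analyticRank_of_analyticRank_le_one) (hmod : hasEntireLFunction_rat)
    (hX : ClassX8 W 3) (hsst : Semistable W) (hr : W.analyticRank = 0)
    {q : ℚ} (hq : shaAn W = (q : ℂ)) (hv : padicValRat 3 q ≤ 4)
    (hcard : 81 ∣ Nat.card (W.selmerGroup (9 : ℤ))) : BSDp W 3 := by
  have h9 : ((3 ^ 2 : ℕ) : ℤ) = 9 := by norm_num
  have hcard' : 3 ^ (2 * 2 - 1) ∣ Nat.card (W.selmerGroup ((3 ^ 2 : ℕ) : ℤ)) := by
    rw [h9]; exact dvd_trans (by norm_num) hcard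
  exact X8.bsdp_rankZero_of_casselsTate_of_dvd_card_selmerGroup_pow_of_semistable W 3 hCT hW hGZK
    hmod hX hsst hr 2 hq (k := 2) (by norm_num; exact hv) hcard'

/-- **X7 ∩ {r_an = 0} ∩ {surj(3)} ∩ {ord_3 #Ш_an ≤ 4} at `p = 3`: `BSD(E,3)` from PUBLISHED theorems +
the level-`9` count `81 ∣ #Sel^(9)(E/ℚ)`** (census targets: class-closure N5@3's 11 cells with
`#Ш_an = 81·u`). [cite: Wuthrich2014, Prop. 21 (p. 400)] [cite: SilvermanAEC2009, Thm. X.4.2(a) and X.4.14]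
[cite: Miller2011LMS, §1 and Def. 1.1] -/
theorem X7.bsdp_three_rankZero_of_card_selmerNine_of_surj
    (hCT : exists_casselsTate_pairing (K := ℚ)) (hW : sha_dvd_analyticSha)
    (hGZK : rank_eq_analyticRank_of_analyticRank_le_one) (hmod : hasEntireLFunction_rat)
    (hX : ClassX7 W 3) (hs : Surj W 3) (hr : W.analyticRank = 0)
    {q : ℚ} (hq : shaAn W = (q : ℂ)) (hv : padicValRat 3 q ≤ 4)
    (hcard : 81 ∣ Nat.card (W.selmerGroup (9 : ℤ))) : BSDp W 3 := by
  have h9 : ((3 ^ 2 : ℕ) : ℤ) = 9 := by norm_num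
  have hcard' : 3 ^ (2 * 2 - 1) ∣ Nat.card (W.selmerGroup ((3 ^ 2 : ℕ) : ℤ)) := by
    rw [h9]; exact dvd_trans (by norm_num) hcard
  exact X7.bsdp_rankZero_of_casselsTate_of_dvd_card_selmerGroup_pow_of_surj W 3 hCT hW hGZK hmod
    (by norm_num) hX hs hr 2 hq (k := 2) (by norm_num; exact hv) hcard'

/-- **X6 ∩ {r_an = 0} ∩ {ord_3 #Ш_an ≤ 4} at `p = 3`: `BSD(E,3)` from PUBLISHED theorems + the level-`9`
count `81 ∣ #Sel^(9)(E/ℚ)`** (census targets: class-closure N4@3's 3 cells with `#Ш_an = 81·u`).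
[cite: Wuthrich2014, Prop. 21 (p. 400)] [cite: SilvermanAEC2009, Thm. X.4.2(a) and X.4.14]
[cite: Miller2011LMS, §1 and Def. 1.1] -/
theorem X6.bsdp_three_rankZero_of_card_selmerNine
    (hCT : exists_casselsTate_pairing (K := ℚ)) (hW : sha_dvd_analyticSha)
    (hGZK : rank_eq_analyticRank_of_analyticRank_le_one) (hmod : hasEntireLFunction_rat)
    (hX : ClassX6 W 3) (hr : W.analyticRank = 0)
    {q : ℚ} (hq : shaAn W = (q : ℂ)) (hv : padicValRat 3 q ≤ 4)
    (hcard : 81 ∣ Nat.card (W.selmerGroup (9 : ℤ))) : BSDp W 3 := by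
  have h9 : ((3 ^ 2 : ℕ) : ℤ) = 9 := by norm_num
  have hcard' : 3 ^ (2 * 2 - 1) ∣ Nat.card (W.selmerGroup ((3 ^ 2 : ℕ) : ℤ)) := by
    rw [h9]; exact dvd_trans (by norm_num) hcard
  exact X6.bsdp_rankZero_of_casselsTate_of_dvd_card_selmerGroup_pow W 3 hCT hW hGZK hmod (by norm_num)
    hX hr 2 hq (k := 2) (by norm_num; exact hv) hcard'

/-! ### §4. Rank `≤ 1`, X6: the count certificate at any level (rank-`1` upper half = Sprung 2024 Cor. 1.3 (ii)) -/

/-- **X6, odd `p`, analytic rank `≤ 1`, `ord_p #Ш_an ≤ 2k`: `BSD(E,p)` from PUBLISHED theorems + the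
count certificate `p ^ (j·r_an + (2k−1)) ∣ #Sel^(p^j)(E/ℚ)`** — the level-`p^j` form of x10b's
`X6.bsdp_of_casselsTate_of_pow_succ_dvd_card_selmerGroup` (`j = k = 1`). Inputs by name: Sprung 2024
Cor. 1.3 (ii) (`hS`, rank-`1` upper half; REFEREED, flags as in `X6RankOneOneSided.lean`), Wuthrich
2014 Prop. 21 (`hW`, rank `0`), Cassels–Tate (`hCT`), GZK (`hGZK`), modularity (`hmod`); consumer
`X6.bsdp_of_missingLowerBoundAt`. Per-pair; NOT a class theorem. [cite: Sprung2024, Cor. 1.3]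
[cite: Wuthrich2014, Prop. 21 (p. 400)] [cite: SilvermanAEC2009, Thm. X.4.14] [cite: Serre1972, §1.11 Prop. 12]
[cite: Miller2011LMS, §1 and Def. 1.1] -/
theorem X6.bsdp_of_casselsTate_of_dvd_card_selmerGroup_pow
    (hS : Sprung2024.cor13_padicValRat_bsd_rank_one_le) (hW : sha_dvd_analyticSha)
    (hCT : exists_casselsTate_pairing (K := ℚ))
    (hGZK : rank_eq_analyticRank_of_analyticRank_le_one) (hmod : hasEntireLFunction_rat)
    (hp : p ≠ 2) (hX : ClassX6 W p) (hr : W.analyticRank ≤ 1) (j : ℕ)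
    {q : ℚ} (hq : shaAn W = (q : ℂ)) {k : ℕ} (hv : padicValRat p q ≤ 2 * k)
    (hcard : p ^ (j * W.analyticRank + (2 * k - 1)) ∣ Nat.card (W.selmerGroup ((p ^ j : ℕ) : ℤ))) :
    BSDp W p :=
  X6.bsdp_of_missingLowerBoundAt W p hS hW hGZK hmod hp hX hr
    (missingLowerBoundAt_of_casselsTate_of_dvd_card_selmerGroup_pow W p hCT hGZK hr j
      (not_dvd_torsionOrder_of_irr W p (ClassX6.irr W p hp hX)) hq hv hcard)

end OverQ

end Summit.BirchSwinnertonDyer.Rank1Residual.Supersingular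

end
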